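/-
Copyright (c) 2026 the pub-hodgecm-mathlib formalisation cell (harness21).  Prover seat hodgecm-mathlib-K2E5-p16 (g4): Track B «K2-LIT»,
hLiu418 = stmt-HodgeConjecture-24832, ROAD Φ organ Φ6b-2 SEQUEL (dealer K2E5-plan (g5) ask 2026-09-04T06:21:58Z: «record the h > 0 vs h ≥ 0
singular (rank-1 h) cases separately»): absolute convergence of Shimura's `η(g, h; α, β)` for `g > 0` and POSITIVE SEMIDEFINITE `h ≥ 0`; 2026-09-04.
-/
import Summits.HodgeConjecture.HodgeConjecture.Theorems.K2LiuHermTwoEtaConvergence             -- ★ p857940 (this seat): the `h > 0` case + dominations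
import HarnessLib

/-!
# Crux `HLiu418`, ROAD Φ, organ Φ6b-2 (sequel): convergence of `η(g, h; α, β)` for SEMIDEFINITE `h ≥ 0` [Shimura1982, §3, Case II, m = κ = 2]

Cell `hodgecm-mathlib`, crux item hLiu418 = `stmt-HodgeConjecture-24832`, route of record `HCCMUnconditional`; squad K2, LEAD F0P6-plan (g12), co-dealer
K2E5-plan (g5), prover K2E5-p16 (g4).  THEOREMS ONLY; lane `--supports stmt-HodgeConjecture-24832 --as helper`.

WHAT.  ★ `integrableOn_etaTwoIntegrand_of_posDef` recorded the `h > 0` case (every `α`, `re β > 1`).  Here the `h ≥ 0` case — which contains the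
SINGULAR `h` (rank 1: the profile `ξ(y, diag(t, 0); α, β)` of Road I's payer of (A3)_τ and Road Φ's rank-1 `β` at `n = 2`, and rank 0: `h = 0`) — on the
UNIFORM abscissa
  `re β > 1  ∧  re(α + β) > 3`:
`integrableOn_etaTwoIntegrand_of_posSemidef`.  For `h = 0` this abscissa is sharp (`η(g, 0; α, β) = Γ₂(α + β − 2) det(g)^{2−α−β}`); for `h > 0` it is
weaker than ★ (all `α`); for rank-1 `h` the sharp half-plane is `re β > 1 ∧ re(α + β) > 2` (chart computation, not typed here).  Below `re β ≤ 1` the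
function `η` is given by continuation [Shimura1982, §4], not by a convergent integral.
PROOF.  Translate `x = u + h` (`u > 0`): the integrand is `e^{−τ((u+h)g)} det(u + 2h)^{α−2} det(u)^{β−2}` and `det u ≤ det(u + 2h)` (`det_add_ge_of_nonneg`,
`2h ≥ 0`).  If `re α ≤ 2`, `det(u+2h)^{re α−2} ≤ det(u)^{re α−2}` and the Siegel–Gindikin integrand at `(g, α + β − 2)` dominates; if `re α > 2`,
`det(u+2h)^{re α−2} ≤ det(u + 2h + 1)^{re α−2} ≤ K e^{τ(ug)/2}` (★ `det_add_rpow_le`) and the Siegel–Gindikin integrand at `(g/2, β)` dominates; the sum of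
the two majorants serves both cases (★ `integrableOn_siegelGindikin_hermTwo`).
HONEST LABEL.  Count-neutral helper of the K2_Liu road; it pays no socket by itself: `HC_CM` is proved only modulo the 7 printed citations
(2 remaining named inputs: hLiu418 = `stmt-HodgeConjecture-24832`, h413 = `stmt-HodgeConjecture-24833`) until rung 0 closes.
-/

set_option autoImplicit false
-- the mandated namespace repeats the single-problem summit's segment (`HodgeConjecture.HodgeConjecture`)
set_option linter.dupNamespace false

noncomputable section

open Complex MeasureTheory Set
open scoped ComplexOrder ComplexConjugate

namespace Summit.HodgeConjecture.HodgeConjecture.Cruxes.HLiu418.K2LiuHermTwoEtaConvergenceSemidefinite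

open Summit.HodgeConjecture.HodgeConjecture.Cruxes.HLiu418.K2LiuHermTwoGammaDefs
open Summit.HodgeConjecture.HodgeConjecture.Cruxes.HLiu418.K2LiuHermTwoGammaSiegelGindikin
open Summit.HodgeConjecture.HodgeConjecture.Cruxes.HLiu418.K2LiuHermTwoEtaDefs
open Summit.HodgeConjecture.HodgeConjecture.Cruxes.HLiu418.K2LiuHermTwoEtaConvergence

/-! ## The semidefinite chart -/

/-- A positive SEMIdefinite `[[a, z],[z̄, b]]` has `a ≥ 0`, `b ≥ 0`, `|z|² ≤ a b`. -/
theorem nonneg_of_posSemidef_hermTwo {c : ℝ × ℂ × ℝ} (hc : (hermTwo c).PosSemidef) :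
    0 ≤ c.1 ∧ 0 ≤ c.2.2 ∧ normSq c.2.1 ≤ c.1 * c.2.2 := by
  have h0 := hc.dotProduct_mulVec_nonneg (Pi.single 0 1)
  have h1 := hc.dotProduct_mulVec_nonneg (Pi.single 1 1)
  rw [star_dotProduct_hermTwo_mulVec, Complex.zero_le_real] at h0 h1
  have e01 : (Pi.single 0 1 : Fin 2 → ℂ) 1 = 0 := by simp
  have e10 : (Pi.single 1 1 : Fin 2 → ℂ) 0 = 0 := by simp
  simp only [Pi.single_eq_same, e01, e10, Complex.normSq_one, mul_one, mul_zero, map_zero, zero_mul,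
    add_zero, zero_add, Complex.zero_re] at h0 h1
  have hdet := hc.det_nonneg
  rw [det_hermTwo, Complex.zero_le_real] at hdet
  exact ⟨h0, h1, by linarith⟩

/-- DETERMINANT MONOTONICITY: for `x = [[a,z],[z̄,b]] > 0` and `k = [[p,w],[w̄,q]] ≥ 0` (semidefinite chart), `det x ≤ det(x + k)`. -/
theorem det_add_ge_of_nonneg {a b p q : ℝ} {z w : ℂ} (ha : 0 < a) (hz : normSq z < a * b) (hp : 0 ≤ p) (hq : 0 ≤ q)
    (hw : normSq w ≤ p * q) : a * b - normSq z ≤ (a + p) * (b + q) - normSq (z + w) := by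
  have hb : 0 < b := snd_pos_of_cone ha hz
  have hρ : (z * conj w).re ≤ ‖z‖ * ‖w‖ := by
    have h := Complex.abs_re_le_norm (z * conj w)
    rw [norm_mul, Complex.norm_conj] at h
    linarith [le_abs_self (z * conj w).re]
  set s := ‖z‖ with hs
  set t := ‖w‖ with ht
  have hs0 : 0 ≤ s := norm_nonneg _
  have ht0 : 0 ≤ t := norm_nonneg _
  have hs2 : s ^ 2 < a * b := by rw [hs, Complex.sq_norm]; exact hz
  have ht2 : t ^ 2 ≤ p * q := by rw [ht, Complex.sq_norm]; exact hw
  have hexp : normSq (z + w) = normSq z + normSq w + 2 * (z * conj w).re := Complex.normSq_add z w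
  -- `a q + b p ≥ 2 s t`
  have hst : 2 * s * t ≤ a * q + b * p := by
    have hsq : (2 * s * t) ^ 2 ≤ (a * q + b * p) ^ 2 := by
      have h4 : s ^ 2 * t ^ 2 ≤ (a * b) * (p * q) := mul_le_mul hs2.le ht2 (sq_nonneg _) (by positivity)
      nlinarith [sq_nonneg (a * q - b * p), h4]
    exact (pow_le_pow_iff_left₀ (by positivity) (by positivity) two_ne_zero).mp hsq
  have hw' : normSq w = t ^ 2 := by rw [ht, Complex.sq_norm]
  rw [hexp, hw']
  nlinarith [hst, hρ, ht2]

/-! ## Absolute convergence of `η` for `g > 0`, `h ≥ 0` -/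

/-- **ABSOLUTE CONVERGENCE OF SHIMURA'S `η` FOR `g > 0` AND SEMIDEFINITE `h ≥ 0`** (organ Φ6b-2, singular half; [Shimura1982, §3, Case II, m = 2]):
for positive definite `g`, positive SEMIdefinite `h` (any rank: `0`, `1`, `2`), `re β > 1` and `re(α + β) > 3`, the integrand of `η(g, h; α, β)` is
integrable on its domain `{x ± h > 0} = {x − h > 0}`. -/
theorem integrableOn_etaTwoIntegrand_of_posSemidef {g h : Matrix (Fin 2) (Fin 2) ℂ} (hg : g.PosDef) (hh : h.PosSemidef) {α β : ℂ}
    (hβ : 1 < β.re) (hαβ : 3 < (α + β).re) : IntegrableOn (etaTwoIntegrand g h α β) (etaTwoSet h) := by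
  have hab : 3 < α.re + β.re := by rw [← Complex.add_re]; exact hαβ
  -- coordinates of `g` and `h`
  have hg' : hermTwo ((g 0 0).re, g 0 1, (g 1 1).re) = g := hermTwo_eq_of_isHermitian hg.1
  have hdg := (posDef_hermTwo_iff ((g 0 0).re, g 0 1, (g 1 1).re)).mp (hg'.symm ▸ hg)
  set d : ℝ × ℂ × ℝ := ((g 0 0).re, g 0 1, (g 1 1).re) with hd
  have hh' : hermTwo ((h 0 0).re, h 0 1, (h 1 1).re) = h := hermTwo_eq_of_isHermitian hh.1
  have he0 := nonneg_of_posSemidef_hermTwo (c := ((h 0 0).re, h 0 1, (h 1 1).re)) (hh'.symm ▸ hh)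
  set e : ℝ × ℂ × ℝ := ((h 0 0).re, h 0 1, (h 1 1).re) with he
  have hp : 0 < d.1 := hdg.1
  have hw : normSq d.2.1 < d.1 * d.2.2 := hdg.2
  have hq : 0 < d.2.2 := snd_pos_of_cone hp hw
  obtain ⟨he1, he2, hez⟩ := he0
  -- `2h` (semidefinite) and `2h + 1` (definite) in the chart
  have h2z : normSq (e.2.1 + e.2.1) = 4 * normSq e.2.1 := by
    rw [show e.2.1 + e.2.1 = (2 : ℂ) * e.2.1 by ring, map_mul, show normSq (2 : ℂ) = 4 by norm_num [normSq_apply]]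
  have h2e : normSq (e.2.1 + e.2.1) ≤ (e.1 + e.1) * (e.2.2 + e.2.2) := by rw [h2z]; nlinarith
  have h2e1 : normSq (e.2.1 + e.2.1) < (e.1 + e.1 + 1) * (e.2.2 + e.2.2 + 1) := by rw [h2z]; nlinarith
  -- the domain is `{x − h > 0}`; translate by `h`
  rw [etaTwoSet_eq_of_posSemidef hh, ← hh']
  have hT : MeasurePreserving (fun c : ℝ × ℂ × ℝ => c + e) volume volume := by
    have h := (measurePreserving_add_right (volume : Measure ℝ) e.1).prod
      ((measurePreserving_add_right (volume : Measure ℂ) e.2.1).prod (measurePreserving_add_right (volume : Measure ℝ) e.2.2))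
    have hf : (fun c : ℝ × ℂ × ℝ => c + e) =
        Prod.map (fun x : ℝ => x + e.1) (Prod.map (fun x : ℂ => x + e.2.1) (fun x : ℝ => x + e.2.2)) := by
      funext c
      rfl
    rw [hf, Measure.volume_eq_prod, Measure.volume_eq_prod]
    exact h
  have hTe : MeasurableEmbedding (fun c : ℝ × ℂ × ℝ => c + e) := (MeasurableEquiv.addRight e).measurableEmbedding
  have hpre : (fun c : ℝ × ℂ × ℝ => c + e) ⁻¹' {c | (hermTwo c - hermTwo e).PosDef} = {c | (hermTwo c).PosDef} := by
    ext c
    simp only [Set.mem_preimage, Set.mem_setOf_eq, hermTwo_add, add_sub_cancel_right]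
  rw [← hT.integrableOn_comp_preimage hTe, hpre]
  -- the key domination constant for `r = re α − 2` and the DEFINITE `k = 2h + 1`
  obtain ⟨K, hK, hKle⟩ := det_add_rpow_le (w := d.2.1) (w' := e.2.1 + e.2.1) (q := d.2.2) (q' := e.2.2 + e.2.2 + 1) hp hw
    (by linarith) h2e1 (α.re - 2)
  -- the two Siegel–Gindikin majorants: at `(g/2, β)` and at `(g, α + β − 2)`
  have hhalf : 0 < ((1 / 2 : ℝ) • d).1 ∧ normSq ((1 / 2 : ℝ) • d).2.1 < ((1 / 2 : ℝ) • d).1 * ((1 / 2 : ℝ) • d).2.2 := by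
    simp only [Prod.smul_fst, Prod.smul_snd, smul_eq_mul, Complex.real_smul]
    refine ⟨by positivity, ?_⟩
    rw [map_mul, show normSq ((1 / 2 : ℝ) : ℂ) = 1 / 4 by rw [normSq_ofReal]; norm_num]
    nlinarith
  have hSG1 := (integrableOn_siegelGindikin_hermTwo ((1 / 2 : ℝ) • d) hhalf (s := (β.re : ℂ)) (by simpa using hβ)).norm.const_mul
    (K * Real.exp (-(e.1 * d.1 + e.2.2 * d.2.2 + 2 * (e.2.1 * conj d.2.1).re)))
  have hSG2 := (integrableOn_siegelGindikin_hermTwo d ⟨hp, hw⟩ (s := ((α.re + β.re - 2 : ℝ) : ℂ))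
    (by simp only [Complex.ofReal_re]; linarith)).norm.const_mul
    (Real.exp (-(e.1 * d.1 + e.2.2 * d.2.2 + 2 * (e.2.1 * conj d.2.1).re)))
  refine (hSG1.add hSG2).mono' ?_ ?_
  · exact ((measurable_etaTwoIntegrand g (hermTwo e) α β).comp (measurable_id.add_const e)).aestronglyMeasurable
  · refine (ae_restrict_iff' measurableSet_posDef_hermTwo).mpr (Filter.Eventually.of_forall fun c hc => ?_)
    have hc' := (posDef_hermTwo_iff c).mp hc
    obtain ⟨a, z, b⟩ := c
    obtain ⟨ha, hz⟩ := hc'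
    have hb : 0 < b := snd_pos_of_cone ha hz
    -- names for the real quantities
    set T : ℝ := a * d.1 + b * d.2.2 + 2 * (z * conj d.2.1).re with hTdef
    set Te : ℝ := e.1 * d.1 + e.2.2 * d.2.2 + 2 * (e.2.1 * conj d.2.1).re with hTedef
    have hdetx : 0 < a * b - normSq z := by linarith
    have hmono1 : a * b - normSq z ≤ (a + (e.1 + e.1)) * (b + (e.2.2 + e.2.2)) - normSq (z + (e.2.1 + e.2.1)) :=
      det_add_ge_of_nonneg ha hz (by linarith) (by linarith) h2e
    have hdet2 : 0 < (a + (e.1 + e.1)) * (b + (e.2.2 + e.2.2)) - normSq (z + (e.2.1 + e.2.1)) := lt_of_lt_of_le hdetx hmono1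
    have hmono2 : (a + (e.1 + e.1)) * (b + (e.2.2 + e.2.2)) - normSq (z + (e.2.1 + e.2.1)) ≤
        (a + (e.1 + e.1 + 1)) * (b + (e.2.2 + e.2.2 + 1)) - normSq (z + (e.2.1 + e.2.1)) := by nlinarith
    have hT0 : 0 ≤ T := trace_mul_nonneg ha hz hp hw
    -- the norms on the left
    have hL1 : ‖cexp (-(hermTwo ((a, z, b) + e) * hermTwo d).trace)‖ = Real.exp (-(T + Te)) := by
      rw [Complex.norm_exp, trace_hermTwo_mul_hermTwo]
      congr 1
      simp only [Prod.fst_add, Prod.snd_add, neg_re, ofReal_re, hTdef, hTedef, add_mul, Complex.add_re, mul_add]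
      ring
    have hL2 : ‖(hermTwo ((a, z, b) + e + e)).det ^ (α - 2)‖ =
        ((a + (e.1 + e.1)) * (b + (e.2.2 + e.2.2)) - normSq (z + (e.2.1 + e.2.1))) ^ (α.re - 2) := by
      have hx : (a, z, b) + e + e = (a + (e.1 + e.1), z + (e.2.1 + e.2.1), b + (e.2.2 + e.2.2)) := by
        ext <;> simp [add_assoc]
      rw [hx, det_hermTwo, norm_cpow_eq_rpow_re_of_pos hdet2]
      simp
    have hL3 : ‖(hermTwo (a, z, b)).det ^ (β - 2)‖ = (a * b - normSq z) ^ (β.re - 2) := by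
      rw [det_hermTwo, norm_cpow_eq_rpow_re_of_pos hdetx]
      simp
    -- the norms on the right
    have hR1 : ‖cexp (-(hermTwo (a, z, b) * hermTwo ((1 / 2 : ℝ) • d)).trace)‖ = Real.exp (-(T / 2)) := by
      rw [Complex.norm_exp, trace_hermTwo_mul_hermTwo]
      congr 1
      simp only [Prod.smul_fst, Prod.smul_snd, smul_eq_mul, Complex.real_smul, neg_re, ofReal_re, hTdef, map_mul,
        Complex.conj_ofReal, Complex.mul_re, Complex.mul_im, Complex.ofReal_re, Complex.ofReal_im, zero_mul, sub_zero, add_zero]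
      ring
    have hR2 : ‖(hermTwo (a, z, b)).det ^ ((β.re : ℂ) - 2)‖ = (a * b - normSq z) ^ (β.re - 2) := by
      rw [det_hermTwo, norm_cpow_eq_rpow_re_of_pos hdetx]
      simp
    have hR3 : ‖cexp (-(hermTwo (a, z, b) * hermTwo d).trace)‖ = Real.exp (-T) := by
      rw [Complex.norm_exp, trace_hermTwo_mul_hermTwo]
      congr 1
    have hR4 : ‖(hermTwo (a, z, b)).det ^ (((α.re + β.re - 2 : ℝ) : ℂ) - 2)‖ = (a * b - normSq z) ^ (α.re + β.re - 2 - 2) := by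
      rw [det_hermTwo, norm_cpow_eq_rpow_re_of_pos hdetx]
      simp
    simp only [Function.comp_apply, Pi.add_apply]
    rw [etaTwoIntegrand_add, ← hg', norm_mul, norm_mul, norm_mul, hL1, hL2, hL3, norm_mul, hR1, hR2, hR3, hR4]
    -- both right-hand terms are nonnegative
    have hP1 : 0 ≤ K * Real.exp (-Te) * (Real.exp (-(T / 2)) * (a * b - normSq z) ^ (β.re - 2)) := by positivity
    have hP2 : 0 ≤ Real.exp (-Te) * (Real.exp (-T) * (a * b - normSq z) ^ (α.re + β.re - 2 - 2)) := by positivity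
    rcases le_or_gt (α.re - 2) 0 with hr | hr
    · -- `re α ≤ 2`: `det(x + 2h)^{re α − 2} ≤ det(x)^{re α − 2}`; the majorant at `(g, α + β − 2)` serves
      have hle : ((a + (e.1 + e.1)) * (b + (e.2.2 + e.2.2)) - normSq (z + (e.2.1 + e.2.1))) ^ (α.re - 2) ≤
          (a * b - normSq z) ^ (α.re - 2) := Real.rpow_le_rpow_of_nonpos hdetx hmono1 hr
      have hX0 : 0 ≤ Real.exp (-(T + Te)) * (a * b - normSq z) ^ (β.re - 2) := by positivity
      calc Real.exp (-(T + Te)) *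
            (((a + (e.1 + e.1)) * (b + (e.2.2 + e.2.2)) - normSq (z + (e.2.1 + e.2.1))) ^ (α.re - 2) * (a * b - normSq z) ^ (β.re - 2))
          = (Real.exp (-(T + Te)) * (a * b - normSq z) ^ (β.re - 2)) *
              ((a + (e.1 + e.1)) * (b + (e.2.2 + e.2.2)) - normSq (z + (e.2.1 + e.2.1))) ^ (α.re - 2) := by ring
        _ ≤ (Real.exp (-(T + Te)) * (a * b - normSq z) ^ (β.re - 2)) * (a * b - normSq z) ^ (α.re - 2) :=
            mul_le_mul_of_nonneg_left hle hX0
        _ = Real.exp (-Te) * (Real.exp (-T) * (a * b - normSq z) ^ (α.re + β.re - 2 - 2)) := by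
            rw [show α.re + β.re - 2 - 2 = (β.re - 2) + (α.re - 2) by ring, Real.rpow_add hdetx, neg_add, Real.exp_add]
            ring
        _ ≤ K * Real.exp (-Te) * (Real.exp (-(T / 2)) * (a * b - normSq z) ^ (β.re - 2)) +
              Real.exp (-Te) * (Real.exp (-T) * (a * b - normSq z) ^ (α.re + β.re - 2 - 2)) := by linarith
    · -- `re α > 2`: `det(x + 2h)^{re α − 2} ≤ det(x + 2h + 1)^{re α − 2} ≤ K e^{T/2}`; the majorant at `(g/2, β)` serves
      have hKc := hKle a b z ha hz
      have hle : ((a + (e.1 + e.1)) * (b + (e.2.2 + e.2.2)) - normSq (z + (e.2.1 + e.2.1))) ^ (α.re - 2) ≤ K * Real.exp (T / 2) :=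
        le_trans (Real.rpow_le_rpow hdet2.le hmono2 hr.le) hKc
      have hX0 : 0 ≤ Real.exp (-(T + Te)) * (a * b - normSq z) ^ (β.re - 2) := by positivity
      calc Real.exp (-(T + Te)) *
            (((a + (e.1 + e.1)) * (b + (e.2.2 + e.2.2)) - normSq (z + (e.2.1 + e.2.1))) ^ (α.re - 2) * (a * b - normSq z) ^ (β.re - 2))
          = (Real.exp (-(T + Te)) * (a * b - normSq z) ^ (β.re - 2)) *
              ((a + (e.1 + e.1)) * (b + (e.2.2 + e.2.2)) - normSq (z + (e.2.1 + e.2.1))) ^ (α.re - 2) := by ring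
        _ ≤ (Real.exp (-(T + Te)) * (a * b - normSq z) ^ (β.re - 2)) * (K * Real.exp (T / 2)) :=
            mul_le_mul_of_nonneg_left hle hX0
        _ = K * Real.exp (-Te) * (Real.exp (-(T / 2)) * (a * b - normSq z) ^ (β.re - 2)) := by
            rw [show -(T + Te) = -Te + -(T / 2) + -(T / 2) by ring, Real.exp_add, Real.exp_add]
            have : Real.exp (-(T / 2)) * Real.exp (T / 2) = 1 := by rw [← Real.exp_add, neg_add_cancel, Real.exp_zero]
            linear_combination (K * Real.exp (-Te) * Real.exp (-(T / 2)) * (a * b - normSq z) ^ (β.re - 2)) * this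
        _ ≤ K * Real.exp (-Te) * (Real.exp (-(T / 2)) * (a * b - normSq z) ^ (β.re - 2)) +
              Real.exp (-Te) * (Real.exp (-T) * (a * b - normSq z) ^ (α.re + β.re - 2 - 2)) := by linarith

/-- `η(g, h; α, β)` for `h ≥ 0` is the integral of its integrand over `{x − h > 0}` (absolutely convergent on `re β > 1 ∧ re(α+β) > 3` when `g > 0`). -/
theorem etaTwo_eq_integral_of_posSemidef (g : Matrix (Fin 2) (Fin 2) ℂ) {h : Matrix (Fin 2) (Fin 2) ℂ} (hh : h.PosSemidef) (α β : ℂ) :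
    etaTwo g h α β = ∫ c in {c : ℝ × ℂ × ℝ | (hermTwo c - h).PosDef}, etaTwoIntegrand g h α β c := by
  rw [etaTwo_def, etaTwoSet_eq_of_posSemidef hh]

end Summit.HodgeConjecture.HodgeConjecture.Cruxes.HLiu418.K2LiuHermTwoEtaConvergenceSemidefinite

end
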